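import Literature.NumberTheory.LFunctions.EquivalentsKeiperLiProofs
import Literature.NumberTheory.LFunctions.FreitasLiHalfPlanesProofs
import Literature.NumberTheory.LFunctions.SekatskiiGeneralizedBombieriLagarias
import Literature.NumberTheory.LFunctions.Voros2006OesterleProofs
import Literature.Analysis.Complex.HolomorphicPrimitives
import Summits.RiemannHypothesis.RiemannHypothesis.Theorems.Splittings.LiCriterionProgressions
import Summits.RiemannHypothesis.RiemannHypothesis.Statement
import Mathlib.Analysis.Complex.TaylorSeries
import Mathlib.Analysis.Complex.RealDeriv
import Mathlib.Analysis.Normed.Ring.InfiniteSum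
import HarnessLib

/-!
# Splittings — Li bridge lens, ONE-SIDED SUB-EXPONENTIAL ENVELOPES of `λ_n`, part 1/4: the analytic core
# (modulus domination, Taylor/twisted Taylor series, logarithm and segment bounds, endgame) — SPLIT-li-bridge gen 4

Cell rh-split, seat rh-split-li-bridge g4 (brief sha16 f79c5f09d8bcb036), card
`run/shared/lean/pub/rh-split/cards/SPLIT-li-bridge.md` §11; zero-definition raw form of
`HOME/rh-split-li-bridge/SketchG4.lean` (sha16 00b14b55d9ac9472; referee rh-split-ref g2 verdict 2026-08-27T03:19:00Z: §11
DELIVERABLE, farm rc 0 / 0 warn / 0 sorry, std axioms on `rh_iff_liSubexpUpper`, `rh_iff_liCesaroBddBelow`; CONTENT PRE-FILE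
PASS «LiOneSidedCriteria{,Cesaro} zero-def carve (§11.3 excluded)»), filed by rh-split-typer-1 g4 in four parts
(`LiOneSidedCriteriaCore`, `LiOneSidedCriteriaTwist`, `LiOneSidedCriteria`, `LiOneSidedCriteriaCesaro`; the 400-line rule).
NOT CARRIED (card §11.3 = the scratch's file-§§8–9 progression rows, CONDITIONAL BOOKKEEPING on unprinted non-resonance):
the two defs `LiProgFloor` / `LiProgNonResonance` and `rh_of_nonResonance_progFloor`, `nonResonance_one`,
`liPhi_ne_zero_of_rh` (tree: `Literature.NumberTheory.LFunctions.liPhi_ne_zero_of_rh`), `nonResonance_of_rh`,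
`rh_iff_nonResonance_and_progFloor`.  The RH-free lemma `resonance_of_progFloor` is kept with `LiProgFloor σ q a` SPELLED OUT
(it is the engine of the `q = 1` criteria), and `rh_of_liFloor` is re-routed through it at `q = 1` (the scratch went through
`rh_of_nonResonance_progFloor` + `nonResonance_one`; same argument, `Finset.range 1` has no `j ≠ 0`).  Proofs otherwise verbatim;
docstrings added where the scratch had none.
HONEST LABEL: «SPLITTING SEARCH over kernel-typed RH-EQUIVALENCES; a splitting A ∧ B ⟹ RH is CONDITIONAL bookkeeping
unless A and B are both proved; nothing here bears on the truth of RH.»  Every theorem below is an RH-EQUIVALENCE (neither side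
asserted) or an RH-FREE implication whose hypothesis is of RH strength; `Summit.RiemannHypothesis` appears only as a
conclusion of such implications or as a hypothesis.

What is in the TREE already (not re-claimed): the LOWER sub-exponential floor
`(∀ ε>0 ∃ c>0 ∀ n≥1, λ_n ≥ -c e^{εn}) → RH` = `Literature.NumberTheory.LFunctions.riemannHypothesis_of_keiperLiCoeff_subexp`
(Bombieri–Lagarias 1999 Thm 1 (c) ⟹ (a)); the TWO-SIDED form `RH ⟺ radius(Σ (λ_k/k) z^k) = 1` =
`Keiper1992_rh_iff_radius_log_holds` (Keiper 1992 §1).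

This part (RH-free complex analysis; credit: g3's `SketchG3.lean` road §§2–3 and the endgame, generalised by g4 from
«eventually non-negative» to «one-sided sub-exponential floor of either sign»):
* §1 modulus domination `‖Σ c_n wⁿ‖ ≤ σ·Re Σ c_n|w|ⁿ + 2·head + 2·Σ d_n|w|ⁿ` for real `c_n` with `σ c_n ≥ -d_n` (`σ = ±1`) —
  the one inequality that replaces positivity (`norm_le_of_hasSum`);
* §2 Taylor series, plain and twisted by a root of unity (`hasSum_taylor`, `hasSum_twist`), absolute convergence
  (`summable_norm_taylor`), division by `1 - w` (`hasSum_partialSums`, Cauchy product);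
* §3 the logarithm: derivative (`hasDerivAt_log_of_exp_eq`), boundedness along a radius ending at a NON-zero
  (`segment_bound`), and the endgame at a zero of least modulus (`endgame`).
Parts 2–4: `LiOneSidedCriteriaTwist` (twisted Li lemma with floors, `φ`-inputs, least zero, resonance),
`LiOneSidedCriteria` (the `q = 1` criteria from EITHER side, increments, the multiset counterexample),
`LiOneSidedCriteriaCesaro` (Cesàro rows).
-/

set_option linter.dupNamespace false

noncomputable section

open Complex Filter Topology Finset
open scoped Nat Real ComplexOrder ComplexConjugate

namespace Summit.RiemannHypothesis.RiemannHypothesis.Theorems.Splittings.LiOneSidedCriteria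

open Literature.NumberTheory.LFunctions
open Summit.RiemannHypothesis.RiemannHypothesis.Theorems.Splittings
open Summit.RiemannHypothesis.RiemannHypothesis.Theorems.Splittings.LiProgression

/-! ## 1. Modulus domination for power series with one-sided floors on real coefficients -/

/-- Scalar form of the domination: `σ x ≥ -m` (`σ = ±1`, `m ≥ 0`) gives `|x| ≤ σ x + 2m`. -/
theorem abs_le_sigma_add {σ x m : ℝ} (hσ : σ = 1 ∨ σ = -1) (hm : 0 ≤ m) (h : -m ≤ σ * x) :
    |x| ≤ σ * x + 2 * m := by
  rcases hσ with rfl | rfl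
  · rw [one_mul] at h ⊢
    rcases le_or_gt 0 x with hx | hx
    · rw [abs_of_nonneg hx]; linarith
    · rw [abs_of_neg hx]; linarith
  · rw [neg_one_mul] at h ⊢
    rcases le_or_gt 0 x with hx | hx
    · rw [abs_of_nonneg hx]; linarith
    · rw [abs_of_neg hx]; linarith

/-- **Domination.** Real coefficients `c_n` (`n ≥ N₀`) with a one-sided floor `σ c_n ≥ -d_n` (`σ = ±1`,
`d_n ≥ 0`): `‖Σ c_n wⁿ‖ ≤ σ Re(Σ c_n |w|ⁿ) + 2 Σ_{n<N₀} ‖c_n‖ + 2 Σ d_n |w|ⁿ`. -/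
theorem norm_le_of_hasSum {c : ℕ → ℂ} {d : ℕ → ℝ} {N₀ : ℕ} {σ : ℝ} (hσ : σ = 1 ∨ σ = -1)
    (hd : ∀ n, 0 ≤ d n) (hc : ∀ n, N₀ ≤ n → (c n).im = 0 ∧ -d n ≤ σ * (c n).re)
    {w : ℂ} (hw : ‖w‖ ≤ 1) {A B : ℂ} (hA : HasSum (fun n ↦ c n * w ^ n) A)
    (hB : HasSum (fun n ↦ c n * ((‖w‖ : ℝ) : ℂ) ^ n) B) {D : ℝ}
    (hD : HasSum (fun n ↦ d n * ‖w‖ ^ n) D) :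
    ‖A‖ ≤ σ * B.re + 2 * ∑ n ∈ Finset.range N₀, ‖c n‖ + 2 * D := by
  have hσabs : |σ| = 1 := by rcases hσ with rfl | rfl <;> simp
  -- a complex number `θ` of norm `≤ 1` with `(θ A).re = ‖A‖`
  set θ : ℂ := conj A / (‖A‖ : ℂ) with hθ
  have hθA : (θ * A).re = ‖A‖ := by
    by_cases hA0 : A = 0
    · simp [hθ, hA0]
    · have hn : (‖A‖ : ℂ) ≠ 0 := by exact_mod_cast (norm_ne_zero_iff.2 hA0)
      have e : θ * A = (‖A‖ : ℂ) := by
        rw [hθ, div_mul_eq_mul_div, Complex.conj_mul', pow_two, mul_div_assoc, div_self hn, mul_one]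
      rw [e, Complex.ofReal_re]
  have hθn : ‖θ‖ ≤ 1 := by
    by_cases hA0 : A = 0
    · simp [hθ, hA0]
    · rw [hθ, norm_div, Complex.norm_conj, Complex.norm_real, Real.norm_eq_abs, abs_norm,
        div_self (norm_ne_zero_iff.2 hA0)]
  -- the three comparison series
  have hsumθ : HasSum (fun n ↦ (θ * (c n * w ^ n)).re) (θ * A).re := Complex.hasSum_re (hA.mul_left θ)
  have h1 : HasSum (fun n ↦ σ * (c n * ((‖w‖ : ℝ) : ℂ) ^ n).re) (σ * B.re) :=
    (Complex.hasSum_re hB).mul_left σ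
  have h2 : HasSum (fun n ↦ if n < N₀ then 2 * ‖c n‖ else (0 : ℝ))
      (∑ n ∈ Finset.range N₀, (if n < N₀ then 2 * ‖c n‖ else (0 : ℝ))) :=
    hasSum_sum_of_ne_finset_zero (fun n hn ↦ by
      rw [Finset.mem_range] at hn
      exact if_neg hn)
  have hval : (∑ n ∈ Finset.range N₀, (if n < N₀ then 2 * ‖c n‖ else (0 : ℝ)))
      = 2 * ∑ n ∈ Finset.range N₀, ‖c n‖ := by
    rw [Finset.mul_sum]
    exact Finset.sum_congr rfl fun n hn ↦ by rw [if_pos (Finset.mem_range.1 hn)]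
  have h3 : HasSum (fun n ↦ 2 * (d n * ‖w‖ ^ n)) (2 * D) := hD.mul_left 2
  have hterm : ∀ n, (θ * (c n * w ^ n)).re ≤
      σ * (c n * ((‖w‖ : ℝ) : ℂ) ^ n).re + (if n < N₀ then 2 * ‖c n‖ else (0 : ℝ))
        + 2 * (d n * ‖w‖ ^ n) := by
    intro n
    have hwn : ‖w‖ ^ n ≤ 1 := pow_le_one₀ (norm_nonneg _) hw
    have hwn0 : 0 ≤ ‖w‖ ^ n := pow_nonneg (norm_nonneg _) _
    have hL : (θ * (c n * w ^ n)).re ≤ ‖c n‖ * ‖w‖ ^ n := by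
      refine (Complex.re_le_norm _).trans ?_
      rw [norm_mul, norm_mul, norm_pow]
      calc ‖θ‖ * (‖c n‖ * ‖w‖ ^ n) ≤ 1 * (‖c n‖ * ‖w‖ ^ n) := by gcongr
        _ = ‖c n‖ * ‖w‖ ^ n := one_mul _
    have eB : (c n * ((‖w‖ : ℝ) : ℂ) ^ n).re = (c n).re * ‖w‖ ^ n := by
      rw [← Complex.ofReal_pow, Complex.re_mul_ofReal]
    rw [eB]
    have hdn := hd n
    by_cases hn : n < N₀
    · rw [if_pos hn]
      have hre : |(c n).re| ≤ ‖c n‖ := Complex.abs_re_le_norm _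
      have hσre : |σ * ((c n).re * ‖w‖ ^ n)| ≤ ‖c n‖ := by
        rw [abs_mul, hσabs, one_mul, abs_mul, abs_of_nonneg hwn0]
        calc |(c n).re| * ‖w‖ ^ n ≤ ‖c n‖ * 1 := by gcongr
          _ = ‖c n‖ := mul_one _
      have h4 := (abs_le.1 hσre).1
      have h5 : ‖c n‖ * ‖w‖ ^ n ≤ ‖c n‖ := by
        calc ‖c n‖ * ‖w‖ ^ n ≤ ‖c n‖ * 1 := by gcongr
          _ = ‖c n‖ := mul_one _
      have h6 : σ * ((c n).re * ‖w‖ ^ n) = σ * (c n).re * ‖w‖ ^ n := by ring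
      nlinarith
    · rw [if_neg hn, add_zero]
      push Not at hn
      obtain ⟨him, hfloor⟩ := hc n hn
      have hnorm : ‖c n‖ = |(c n).re| := by
        have e : c n = ((c n).re : ℂ) := Complex.ext (by simp) (by simp [him])
        rw [e, Complex.norm_real, Real.norm_eq_abs, Complex.ofReal_re]
      have habs := abs_le_sigma_add hσ hdn hfloor
      calc (θ * (c n * w ^ n)).re ≤ ‖c n‖ * ‖w‖ ^ n := hL
        _ = |(c n).re| * ‖w‖ ^ n := by rw [hnorm]
        _ ≤ (σ * (c n).re + 2 * d n) * ‖w‖ ^ n := by gcongr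
        _ = σ * ((c n).re * ‖w‖ ^ n) + 2 * (d n * ‖w‖ ^ n) := by ring
  have hle := hasSum_le hterm hsumθ ((h1.add h2).add h3)
  rw [hθA, hval] at hle
  linarith

/-! ## 2. Taylor series: plain and twisted (g3 §2) -/

/-- Taylor series of a function holomorphic on `|w| < r`, summed at a point of the disc (Mathlib's
`Complex.hasSum_taylorSeries_on_ball`, coefficients written as `iteratedDeriv n ℓ 0 / n!`). -/
theorem hasSum_taylor {ℓ : ℂ → ℂ} {r : ℝ} (hℓ : DifferentiableOn ℂ ℓ (Metric.ball 0 r)) {w : ℂ}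
    (hw : w ∈ Metric.ball (0 : ℂ) r) :
    HasSum (fun n ↦ (n ! : ℂ)⁻¹ * iteratedDeriv n ℓ 0 * w ^ n) (ℓ w) := by
  have h := Complex.hasSum_taylorSeries_on_ball hℓ hw
  have hfun : (fun n ↦ (n ! : ℂ)⁻¹ * iteratedDeriv n ℓ 0 * w ^ n)
      = fun n ↦ (n ! : ℂ)⁻¹ • (w - 0) ^ n • iteratedDeriv n ℓ 0 := by
    funext n
    simp only [sub_zero, smul_eq_mul]
    ring
  rw [hfun]
  exact h

/-- The TWISTED Taylor series: for `|ζ| = 1`, `Σ_n (ℓ⁽ⁿ⁾(0)/n!)(Σ_{j<q} (ζ^j)^{n+b}) wⁿ = Σ_{j<q} (ζ^j)^b ℓ(ζ^j w)`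
(g3 §2: the root-of-unity filter that isolates a residue class of Taylor coefficients). -/
theorem hasSum_twist {ℓ : ℂ → ℂ} {r : ℝ} (hℓ : DifferentiableOn ℂ ℓ (Metric.ball 0 r)) {ζ : ℂ}
    (hζ : ‖ζ‖ = 1) (q b : ℕ) {w : ℂ} (hw : w ∈ Metric.ball (0 : ℂ) r) :
    HasSum (fun n ↦ ((n ! : ℂ)⁻¹ * iteratedDeriv n ℓ 0 *
        ∑ j ∈ Finset.range q, (ζ ^ j) ^ (n + b)) * w ^ n)
      (∑ j ∈ Finset.range q, (ζ ^ j) ^ b * ℓ (ζ ^ j * w)) := by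
  have hjw : ∀ j : ℕ, ζ ^ j * w ∈ Metric.ball (0 : ℂ) r := fun j ↦ by
    rw [Metric.mem_ball, dist_zero_right, norm_mul, norm_pow, hζ, one_pow, one_mul]
    rwa [Metric.mem_ball, dist_zero_right] at hw
  have h := hasSum_sum fun j (_ : j ∈ Finset.range q) ↦
    (Complex.hasSum_taylorSeries_on_ball hℓ (hjw j)).mul_left ((ζ ^ j) ^ b)
  have hfun : (fun n ↦ ((n ! : ℂ)⁻¹ * iteratedDeriv n ℓ 0 *
        ∑ j ∈ Finset.range q, (ζ ^ j) ^ (n + b)) * w ^ n)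
      = fun n ↦ ∑ j ∈ Finset.range q,
          (ζ ^ j) ^ b * ((n ! : ℂ)⁻¹ • (ζ ^ j * w - 0) ^ n • iteratedDeriv n ℓ 0) := by
    funext n
    rw [Finset.mul_sum, Finset.sum_mul]
    refine Finset.sum_congr rfl fun j _ ↦ ?_
    simp only [smul_eq_mul, sub_zero, mul_pow, pow_add]
    ring
  rw [hfun]
  exact h

/-- Absolute convergence of the Taylor series strictly inside the disc of holomorphy. -/
theorem summable_norm_taylor {ℓ : ℂ → ℂ} {r : ℝ} (hℓ : DifferentiableOn ℂ ℓ (Metric.ball 0 r))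
    {w : ℂ} (hw : ‖w‖ < r) :
    Summable (fun n ↦ ‖(n ! : ℂ)⁻¹ * iteratedDeriv n ℓ 0 * w ^ n‖) := by
  obtain ⟨r', hwr', hr'r⟩ := exists_between hw
  have hr'0 : 0 < r' := (norm_nonneg w).trans_lt hwr'
  have hmem : ((r' : ℝ) : ℂ) ∈ Metric.ball (0 : ℂ) r := by
    rw [Metric.mem_ball, dist_zero_right, Complex.norm_real, Real.norm_eq_abs, abs_of_pos hr'0]
    exact hr'r
  have ht := ((hasSum_taylor hℓ hmem).summable.tendsto_atTop_zero).norm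
  rw [norm_zero] at ht
  have hev : ∀ᶠ n in atTop, ‖(n ! : ℂ)⁻¹ * iteratedDeriv n ℓ 0 * ((r' : ℝ) : ℂ) ^ n‖ < 1 :=
    (tendsto_order.1 ht).2 1 one_pos
  have hρ0 : 0 ≤ ‖w‖ / r' := by positivity
  have hρ1 : ‖w‖ / r' < 1 := (div_lt_one hr'0).2 hwr'
  refine Summable.of_norm_bounded_eventually_nat (summable_geometric_of_lt_one hρ0 hρ1) ?_
  filter_upwards [hev] with n hn
  rw [norm_norm]
  have e1 : ‖(n ! : ℂ)⁻¹ * iteratedDeriv n ℓ 0 * w ^ n‖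
      = ‖(n ! : ℂ)⁻¹ * iteratedDeriv n ℓ 0‖ * ‖w‖ ^ n := by
    rw [norm_mul, norm_pow]
  have e2 : ‖(n ! : ℂ)⁻¹ * iteratedDeriv n ℓ 0 * ((r' : ℝ) : ℂ) ^ n‖
      = ‖(n ! : ℂ)⁻¹ * iteratedDeriv n ℓ 0‖ * r' ^ n := by
    rw [norm_mul, norm_pow, Complex.norm_real, Real.norm_eq_abs, abs_of_pos hr'0]
  have e3 : ‖w‖ ^ n = r' ^ n * (‖w‖ / r') ^ n := by
    rw [← mul_pow]
    congr 1
    field_simp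
  rw [e1, e3, ← mul_assoc, ← e2]
  exact mul_le_of_le_one_left (pow_nonneg hρ0 _) hn.le

/-- Division by `1 - w`: the partial sums of the Taylor coefficients are the coefficients of
`ℓ(w)·(1 - w)⁻¹` (Cauchy product with the geometric series). -/
theorem hasSum_partialSums {ℓ : ℂ → ℂ} {r : ℝ} (hℓ : DifferentiableOn ℂ ℓ (Metric.ball 0 r))
    (hr1 : r ≤ 1) {w : ℂ} (hw : ‖w‖ < r) :
    HasSum (fun N ↦ (∑ n ∈ Finset.range (N + 1), (n ! : ℂ)⁻¹ * iteratedDeriv n ℓ 0) * w ^ N)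
      (ℓ w * (1 - w)⁻¹) := by
  have hw1 : ‖w‖ < 1 := hw.trans_le hr1
  have hwball : w ∈ Metric.ball (0 : ℂ) r := by rwa [Metric.mem_ball, dist_zero_right]
  have hf := summable_norm_taylor hℓ hw
  have hg : Summable (fun n ↦ ‖w ^ n‖) := by
    simp_rw [norm_pow]
    exact summable_geometric_of_lt_one (norm_nonneg _) hw1
  have h := hasSum_sum_range_mul_of_summable_norm hf hg
  rw [(hasSum_taylor hℓ hwball).tsum_eq, (hasSum_geometric_of_norm_lt_one hw1).tsum_eq] at h
  have hfun : (fun N ↦ (∑ n ∈ Finset.range (N + 1), (n ! : ℂ)⁻¹ * iteratedDeriv n ℓ 0) * w ^ N)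
      = fun N ↦ ∑ k ∈ Finset.range (N + 1),
          (k ! : ℂ)⁻¹ * iteratedDeriv k ℓ 0 * w ^ k * w ^ (N - k) := by
    funext N
    rw [Finset.sum_mul]
    refine Finset.sum_congr rfl fun k hk ↦ ?_
    have hkN : k ≤ N := Nat.lt_succ_iff.1 (Finset.mem_range.1 hk)
    rw [mul_assoc _ (w ^ k), ← pow_add, Nat.add_sub_cancel' hkN]
  rw [hfun]
  exact h

/-! ## 3. The logarithm: derivative and segment bounds (g3 §3) -/

/-- A holomorphic logarithm `ℓ` of `f` on an open set (`f = exp ∘ ℓ`) has derivative `f'/f`. -/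
theorem hasDerivAt_log_of_exp_eq {f ℓ : ℂ → ℂ} {U : Set ℂ} (hU : IsOpen U)
    (hℓ : DifferentiableOn ℂ ℓ U) (hfl : ∀ z ∈ U, f z = exp (ℓ z)) {w : ℂ} (hw : w ∈ U) :
    HasDerivAt ℓ (deriv f w / f w) w := by
  have hℓw : HasDerivAt ℓ (deriv ℓ w) w := (hℓ.differentiableAt (hU.mem_nhds hw)).hasDerivAt
  have hexp : HasDerivAt (fun z ↦ exp (ℓ z)) (exp (ℓ w) * deriv ℓ w) w := hℓw.cexp
  have hfeq : f =ᶠ[𝓝 w] fun z ↦ exp (ℓ z) :=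
    Filter.eventually_of_mem (hU.mem_nhds hw) fun z hz ↦ hfl z hz
  have hf : HasDerivAt f (exp (ℓ w) * deriv ℓ w) w := hfeq.hasDerivAt_iff.mpr hexp
  have hfw : f w ≠ 0 := by rw [hfl w hw]; exact exp_ne_zero _
  rw [hf.deriv, ← hfl w hw, mul_div_cancel_left₀ _ hfw]
  exact hℓw

/-- Along a radius ending at a NON-zero of `f`, the logarithm stays bounded. -/
theorem segment_bound {f ℓ : ℂ → ℂ} {r₀ : ℝ} (hr₀ : 0 < r₀) (hr₁ : r₀ < 1)
    (hf : DifferentiableOn ℂ f (Metric.ball 0 1)) (hℓ : DifferentiableOn ℂ ℓ (Metric.ball 0 r₀))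
    (hfl : ∀ z ∈ Metric.ball (0 : ℂ) r₀, f z = exp (ℓ z)) {p : ℂ} (hp : ‖p‖ = r₀)
    (hfp : f p ≠ 0) :
    ∃ M : ℝ, ∀ u ∈ Set.Ico (0 : ℝ) 1, ‖ℓ (u * p)‖ ≤ M := by
  set K : Set ℂ := (fun u : ℝ ↦ (u : ℂ) * p) '' Set.Icc 0 1 with hK
  have hKc : IsCompact K := isCompact_Icc.image (Complex.continuous_ofReal.mul continuous_const)
  have hK1 : K ⊆ Metric.ball 0 1 := by
    rintro _ ⟨u, ⟨hu0, hu1⟩, rfl⟩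
    rw [Metric.mem_ball, dist_zero_right, norm_mul, Complex.norm_real, Real.norm_eq_abs,
      abs_of_nonneg hu0, hp]
    nlinarith
  have hKf : ∀ z ∈ K, f z ≠ 0 := by
    rintro _ ⟨u, ⟨hu0, hu1⟩, rfl⟩
    rcases hu1.eq_or_lt with rfl | hu1
    · simpa using hfp
    · intro h0
      have hmem : (u : ℂ) * p ∈ Metric.ball (0 : ℂ) r₀ := by
        rw [Metric.mem_ball, dist_zero_right, norm_mul, Complex.norm_real, Real.norm_eq_abs,
          abs_of_nonneg hu0, hp]
        nlinarith
      rw [hfl _ hmem] at h0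
      exact exp_ne_zero _ h0
  have hcont : ContinuousOn (fun z ↦ deriv f z / f z) K :=
    ((hf.analyticOnNhd Metric.isOpen_ball).deriv.continuousOn.mono hK1).div
      (hf.continuousOn.mono hK1) hKf
  obtain ⟨C, hC⟩ := hKc.exists_bound_of_continuousOn hcont
  refine ⟨‖ℓ 0‖ + |C| * r₀, fun u₁ hu₁ ↦ ?_⟩
  obtain ⟨hu₁0, hu₁1⟩ := hu₁
  have hseg : ∀ x ∈ Set.Icc (0 : ℝ) u₁, (x : ℂ) * p ∈ Metric.ball (0 : ℂ) r₀ := fun x hx ↦ by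
    rw [Metric.mem_ball, dist_zero_right, norm_mul, Complex.norm_real, Real.norm_eq_abs,
      abs_of_nonneg hx.1, hp]
    nlinarith [hx.2]
  have hderiv : ∀ x ∈ Set.Icc (0 : ℝ) u₁,
      HasDerivWithinAt (fun u : ℝ ↦ ℓ (u * p)) (deriv f (x * p) / f (x * p) * p)
        (Set.Icc 0 u₁) x := by
    intro x hx
    have h1 : HasDerivAt ℓ (deriv f (x * p) / f (x * p)) ((x : ℂ) * p) :=
      hasDerivAt_log_of_exp_eq Metric.isOpen_ball hℓ hfl (hseg x hx)
    have h2 : HasDerivAt (fun w : ℂ ↦ ℓ (w * p)) (deriv f (x * p) / f (x * p) * p) (x : ℂ) := by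
      have := h1.comp (x : ℂ) (hasDerivAt_mul_const p)
      simpa [Function.comp_def] using this
    exact h2.comp_ofReal.hasDerivWithinAt
  have hbound : ∀ x ∈ Set.Ico (0 : ℝ) u₁, ‖deriv f (x * p) / f (x * p) * p‖ ≤ |C| * r₀ := by
    intro x hx
    rw [norm_mul, hp]
    exact mul_le_mul_of_nonneg_right
      ((hC _ ⟨x, ⟨hx.1, hx.2.le.trans hu₁1.le⟩, rfl⟩).trans (le_abs_self C)) hr₀.le
  have hmv := norm_image_sub_le_of_norm_deriv_le_segment' hderiv hbound u₁
    (Set.right_mem_Icc.2 hu₁0)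
  simp only [Complex.ofReal_zero, zero_mul, sub_zero] at hmv
  have h1 : ‖ℓ (u₁ * p)‖ ≤ ‖ℓ (u₁ * p) - ℓ 0‖ + ‖ℓ 0‖ := by
    calc ‖ℓ (u₁ * p)‖ = ‖(ℓ (u₁ * p) - ℓ 0) + ℓ 0‖ := by rw [sub_add_cancel]
      _ ≤ _ := norm_add_le _ _
  have h2 : |C| * r₀ * u₁ ≤ |C| * r₀ := by
    have : 0 ≤ |C| * r₀ := by positivity
    nlinarith
  linarith

/-- **Endgame.** A zero `z₀` of `f` on the circle `|w| = r₀`, `f` zero-free inside: `log |f(u z₀)|` cannot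
stay bounded below as `u → 1⁻`. -/
theorem endgame {f : ℂ → ℂ} {r₀ : ℝ} (hr₀ : 0 < r₀) (hr₁ : r₀ < 1)
    (hf : DifferentiableOn ℂ f (Metric.ball 0 1))
    (hfree : ∀ z ∈ Metric.ball (0 : ℂ) r₀, f z ≠ 0) {z₀ : ℂ} (hz₀ : ‖z₀‖ = r₀) (hfz₀ : f z₀ = 0)
    {D : ℝ} (key : ∀ u ∈ Set.Ico (0 : ℝ) 1, -D ≤ Real.log ‖f (u * z₀)‖) : False := by
  have hz₀ball : z₀ ∈ Metric.ball (0 : ℂ) 1 := by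
    rw [Metric.mem_ball, dist_zero_right, hz₀]; exact hr₁
  have hcont : ContinuousAt f z₀ := hf.continuousOn.continuousAt (Metric.isOpen_ball.mem_nhds hz₀ball)
  obtain ⟨δ, hδpos, hδ⟩ := Metric.continuousAt_iff.1 hcont (Real.exp (-D)) (Real.exp_pos _)
  have hmpos : 0 < min (1 / 2 : ℝ) (δ / 2) := lt_min (by norm_num) (by linarith)
  have hmle : min (1 / 2 : ℝ) (δ / 2) ≤ δ / 2 := min_le_right _ _
  have hmle' : min (1 / 2 : ℝ) (δ / 2) ≤ 1 / 2 := min_le_left _ _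
  obtain ⟨u, hudef⟩ : ∃ u : ℝ, u = 1 - min (1 / 2 : ℝ) (δ / 2) := ⟨_, rfl⟩
  have hu0 : 0 ≤ u := by rw [hudef]; linarith
  have hu1 : u < 1 := by rw [hudef]; linarith
  have hdist : dist ((u : ℂ) * z₀) z₀ < δ := by
    rw [dist_eq_norm, show (u : ℂ) * z₀ - z₀ = ((u - 1 : ℝ) : ℂ) * z₀ by push_cast; ring,
      norm_mul, Complex.norm_real, Real.norm_eq_abs, hz₀, hudef,
      show (1 - min (1 / 2 : ℝ) (δ / 2) - 1 : ℝ) = -(min (1 / 2 : ℝ) (δ / 2)) by ring, abs_neg,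
      abs_of_pos hmpos]
    nlinarith [mul_le_mul_of_nonneg_left hr₁.le hmpos.le]
  have hsmall : ‖f (u * z₀)‖ < Real.exp (-D) := by
    have := hδ hdist
    rwa [hfz₀, dist_zero_right] at this
  have hfpos : 0 < ‖f (u * z₀)‖ := by
    refine norm_pos_iff.2 (hfree _ ?_)
    rw [Metric.mem_ball, dist_zero_right, norm_mul, Complex.norm_real, Real.norm_eq_abs,
      abs_of_nonneg hu0, hz₀]
    exact mul_lt_of_lt_one_left hr₀ hu1
  have hlog := Real.log_lt_log hfpos hsmall
  rw [Real.log_exp] at hlog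
  have hkey := key u ⟨hu0, hu1⟩
  linarith

end Summit.RiemannHypothesis.RiemannHypothesis.Theorems.Splittings.LiOneSidedCriteria

end
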